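import Literature.Topology.FourManifolds.StretchSequence
import Literature.Topology.FourManifolds.CellSubcomplex
import Mathlib.LinearAlgebra.Dual.Lemmas
import HarnessLib

/-!
# Cone shadows of singular cells; the cone-shadow stretch (Rushing, Lemma 1.6.3 with Exercise 1.6.12)

The step of Stallings' engulfing (Rushing, *Topological Embeddings* (1973), proof of
Thm. 4.2.1, and the chartwise step of the topological engulfing Thm. 4.12.1) in which the
engulfing open set is stretched over one simplex `A = a * B` of the homotopy track while the
*shadow* of the singular set `Σ ⊆ A` is kept fixed.  Rushing obtains the shadow from
Lemma 1.6.3 (*"there is a subpolyhedron `Λ` … such that `Σ ⊂ P ∪ Λ`, `Q ↘ P ∪ Λ ↘ P` and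
`dim Λ ≤ dim Σ + 1`"*), whose proof goes through Thm. 1.6.3 (simplicial collapses after
subdivision).  For a single simplex there is an explicit shadow avoiding Thm. 1.6.3: the **cone
shadow** `a * π_a(Σ)`, where `π_a` is the radial projection from the vertex `a` onto the free
face `conv B`.  Here the singular set is given, as general position delivers it
(`Literature.Analysis.Convexity.dblSet_subset_of_relGenPos`), by finitely many affine subspaces
`A ℓ` (the cells `conv T ∩ A ℓ`).

* `exists_mem_affineSubspace_iff_forall_eq_zero` — H-description of an affine subspace (common
  zero set of finitely many affine functionals; dual annihilator of the direction).
* `radialCell a A = {y | ∃ s ∈ (0, 1], (1 - s) a + s y ∈ A}` — the radial projection of the cell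
  of `A` from `a`; `eq_or_exists_mem_radialCell` (`Σ ⊆ {a} ∪ a * radialCell`);
  `radialCell_eq_cellSet` (**it is a closed cell of an arrangement**: `{ψ i = 0}` if `a ∈ A`,
  else `{-ψ' ≥ 0} ∩ {ψ i - ψ i (a) ψ' = 0}` with `ψ' = ψ i₀ / ψ i₀ (a)`);
  `card_le_of_subset_radialCell` (**`dim Λ ≤ dim Σ + 1`**: affinely independent points of the
  radial cell inside a flat `N₀ ∌ a` number `≤ dim A + 1`, since the cell lies in the join of `a`
  and `A`, whose trace on `N₀` is a proper sub-flat).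
* `exists_coneShadow_triangulation` — **the cone-shadow triangulation and stretch**: for an
  affinely independent `T`, `a ∈ T` with nonempty free face `B`, and affine subspaces `A ℓ`, a
  finite triangulation `K` of `conv B` (from `exists_triangulation_cells_subcomplex`, adapted to
  the radial cells) and a subfamily `K₀` closed under subfaces such that the subcone `a * K₀`
  contains the horn `a * ∂B` and all cells `conv T ∩ A ℓ`; every face of `K₀` cones into the horn
  or lies in a radial cell with the dimension bound; `a * K = conv T`; and every open `O ⊇ a * K₀`
  is stretched over `conv T` by a homeomorphism fixed on any closed `F` with
  `F ∩ conv T ⊆ a * K₀` and supported in a compact subset of any open `N ⊇ conv T`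
  (`exists_homeomorph_coneOver_subset_image`, the cone collapse `a * K ↘ a * K₀`).

Everything is proved; `radialCell` is the only definition; no named facts.

## References

* T. B. Rushing, *Topological Embeddings*, Academic Press (1973), §1.6, Lemma 1.6.3,
  Exercise 1.6.12; §4.2, proof of Thm. 4.2.1 (the shadows `Σ_j`, `Λ`). [Rushing1973]
-/

open Set Function Metric Filter
open scoped Topology

noncomputable section

namespace Literature.Topology.FourManifolds

/-! ### Cone shadows: radial projection of the cells of the singular set -/

section ConeShadow

variable {E : Type*} [NormedAddCommGroup E] [NormedSpace ℝ E] [FiniteDimensional ℝ E]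

/-- **H-description of an affine subspace**: every affine subspace of a finite-dimensional real
vector space is the common zero set of finitely many affine functionals. [folklore] -/
theorem exists_mem_affineSubspace_iff_forall_eq_zero (A : AffineSubspace ℝ E) :
    ∃ (m : ℕ) (ψ : Fin m → E →ᵃ[ℝ] ℝ), ∀ x, x ∈ A ↔ ∀ i, ψ i x = 0 := by
  rcases (A : Set E).eq_empty_or_nonempty with hA | ⟨p₀, hp₀⟩
  · refine ⟨1, fun _ => AffineMap.const ℝ E 1, fun x => ?_⟩
    constructor
    · intro hx
      have : x ∈ (A : Set E) := hx
      rw [hA] at this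
      exact absurd this (notMem_empty x)
    · intro h
      exact absurd (h 0) (by simp)
  · set W := A.direction with hW
    set Ann := W.dualAnnihilator with hAnn
    haveI : Module.Free ℝ Ann := Module.Free.of_divisionRing ℝ Ann
    haveI : Module.Finite ℝ Ann := by rw [hAnn]; infer_instance
    set b := Module.finBasis ℝ Ann with hb
    refine ⟨Module.finrank ℝ Ann, fun i => ((b i : Module.Dual ℝ E) : E →ₗ[ℝ] ℝ).toAffineMap +
      AffineMap.const ℝ E (-((b i : Module.Dual ℝ E) p₀)), fun x => ?_⟩
    have happly : ∀ i, (((b i : Module.Dual ℝ E) : E →ₗ[ℝ] ℝ).toAffineMap +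
        AffineMap.const ℝ E (-((b i : Module.Dual ℝ E) p₀))) x = (b i : Module.Dual ℝ E) (x - p₀) := by
      intro i
      simp only [AffineMap.coe_add, AffineMap.coe_const, Pi.add_apply, Function.const_apply,
        LinearMap.coe_toAffineMap, map_sub]
      ring
    simp_rw [happly]
    rw [← AffineSubspace.vsub_right_mem_direction_iff_mem ((AffineSubspace.mem_coe p₀ A).1 hp₀) x,
      vsub_eq_sub, ← hW,
      ← Subspace.forall_mem_dualAnnihilator_apply_eq_zero_iff W (x - p₀)]
    constructor
    · intro h i
      exact h _ (b i).2
    · intro h φ hφ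
      have hrepr := b.sum_repr ⟨φ, hφ⟩
      have hφeq : φ = ∑ i, b.repr ⟨φ, hφ⟩ i • (b i : Module.Dual ℝ E) := by
        have := congrArg Subtype.val hrepr
        simpa only [Submodule.coe_sum, Submodule.coe_smul] using this.symm
      rw [hφeq, LinearMap.sum_apply]
      exact Finset.sum_eq_zero fun i _ => by rw [LinearMap.smul_apply, h i, smul_zero]

/-- The **radial cell** of an affine subspace `A` seen from the apex `a`: the points `y` such
that the segment from `a` to `y`, apex excluded, meets `A` — `{y | ∃ s ∈ (0, 1], (1-s) a + s y ∈ A}`.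
Its cone from `a` is the *shadow* of `conv T ∩ A` (Rushing, Lemma 1.6.3: the polyhedron `Λ`
with `Σ ⊆ P ∪ Λ`, `dim Λ ≤ dim Σ + 1`). [folklore] -/
def radialCell (a : E) (A : AffineSubspace ℝ E) : Set E :=
  {y | ∃ s : ℝ, 0 < s ∧ s ≤ 1 ∧ (1 - s) • a + s • y ∈ A}

omit [FiniteDimensional ℝ E] in
/-- **The singular cell is in the cone shadow**: a point of `conv ({a} ∪ S)` lying in `A` is the
apex or lies on a segment from the apex to a point of `conv S` in the radial cell. [folklore] -/
theorem eq_or_exists_mem_radialCell {a : E} {S : Set E} (hS : S.Nonempty) {A : AffineSubspace ℝ E}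
    {p : E} (hp : p ∈ convexHull ℝ (insert a S)) (hpA : p ∈ A) :
    p = a ∨ ∃ y ∈ convexHull ℝ S, y ∈ radialCell a A ∧ p ∈ segment ℝ a y := by
  rw [convexHull_insert hS, convexJoin_singleton_left] at hp
  obtain ⟨y, hy, hpy⟩ := mem_iUnion₂.1 hp
  obtain ⟨s, hs, rfl⟩ := (segment_eq_image ℝ a y ▸ hpy :
    p ∈ (fun θ : ℝ => (1 - θ) • a + θ • y) '' Icc 0 1)
  rcases hs.1.eq_or_lt with rfl | hs0
  · left; simp
  · exact Or.inr ⟨y, hy, ⟨s, hs0, hs.2, hpA⟩, hpy⟩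

omit [FiniteDimensional ℝ E] in
/-- An affine functional along a segment. [folklore] -/
theorem affineMap_combo (ψ : E →ᵃ[ℝ] ℝ) (a y : E) (s : ℝ) :
    ψ ((1 - s) • a + s • y) = (1 - s) * ψ a + s * ψ y := by
  have h : (1 - s) • a + s • y = AffineMap.lineMap a y s := (AffineMap.lineMap_apply_module a y s).symm
  rw [h, AffineMap.apply_lineMap, AffineMap.lineMap_apply_module, smul_eq_mul, smul_eq_mul]

omit [FiniteDimensional ℝ E] in
/-- **Radial cells are cells of an arrangement.**  If `A = {ψ i = 0, ∀ i}`, then the radial cell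
of `A` from `a` is a closed cell `{L j ≥ 0 (j ∈ J), L j = 0 (j ∈ Z)}` of finitely many affine
functionals: if `a ∈ A` it is `{ψ i = 0}`; otherwise, with `ψ' = ψ i₀ / ψ i₀ (a)` for some
`ψ i₀ (a) ≠ 0`, it is `{-ψ' ≥ 0} ∩ {ψ i - ψ i (a) ψ' = 0}`. [folklore] -/
theorem radialCell_eq_cellSet {a : E} {A : AffineSubspace ℝ E} {m : ℕ} {ψ : Fin m → E →ᵃ[ℝ] ℝ}
    (hψ : ∀ x, x ∈ A ↔ ∀ i, ψ i x = 0) :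
    ∃ (L : Option (Fin m) → E →ᵃ[ℝ] ℝ) (J Z : Set (Option (Fin m))),
      radialCell a A = cellSet L J Z := by
  by_cases ha : ∀ i, ψ i a = 0
  · -- `a ∈ A`: the cell is `A` itself
    refine ⟨fun o => o.elim (AffineMap.const ℝ E 0) ψ, ∅, range some, ?_⟩
    ext y
    simp only [radialCell, mem_setOf_eq, mem_cellSet_iff, mem_empty_iff_false, false_imp_iff,
      imp_true_iff, true_and, mem_range, forall_exists_index, forall_apply_eq_imp_iff,
      Option.elim]
    constructor
    · rintro ⟨s, hs0, -, hsA⟩ i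
      have h := (hψ _).1 hsA i
      rw [affineMap_combo, ha i, mul_zero, zero_add] at h
      exact (mul_eq_zero.1 h).resolve_left hs0.ne'
    · intro h
      refine ⟨1, one_pos, le_rfl, (hψ _).2 fun i => ?_⟩
      rw [affineMap_combo, ha i, h i]; ring
  · push Not at ha
    obtain ⟨i₀, hi₀⟩ := ha
    set c := ψ i₀ a with hc
    set ψ' : E →ᵃ[ℝ] ℝ := c⁻¹ • ψ i₀ with hψ'
    have hψ'a : ψ' a = 1 := by rw [hψ', AffineMap.coe_smul, Pi.smul_apply, smul_eq_mul, ← hc, inv_mul_cancel₀ hi₀]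
    have hψ'app : ∀ y, ψ' y = c⁻¹ * ψ i₀ y := fun y => rfl
    refine ⟨fun o => o.elim (-ψ') fun i => ψ i - (ψ i a) • ψ', {none}, range some, ?_⟩
    ext y
    simp only [radialCell, mem_setOf_eq, mem_cellSet_iff, mem_singleton_iff, forall_eq,
      Option.elim, mem_range, forall_exists_index, forall_apply_eq_imp_iff, AffineMap.coe_neg,
      Pi.neg_apply, AffineMap.coe_sub, AffineMap.coe_smul, Pi.sub_apply, Pi.smul_apply,
      smul_eq_mul, neg_nonneg, sub_eq_zero]
    constructor
    · rintro ⟨s, hs0, hs1, hsA⟩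
      have hall := (hψ _).1 hsA
      -- from `i₀`: `(1 - s) + s ψ' y = 0`
      have h0 : (1 - s) + s * ψ' y = 0 := by
        have h := hall i₀
        rw [affineMap_combo, ← hc] at h
        have h' := congrArg (fun z => c⁻¹ * z) h
        simp only [mul_zero, mul_add] at h'
        rw [hψ'app]
        calc (1 - s) + s * (c⁻¹ * ψ i₀ y) = c⁻¹ * ((1 - s) * c) + c⁻¹ * (s * ψ i₀ y) := by
              field_simp
          _ = 0 := h'
      constructor
      · -- `ψ' y ≤ 0`
        nlinarith
      · intro i
        have h := hall i
        rw [affineMap_combo] at h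
        -- `(1 - s) = - s ψ' y`
        have h1s : (1 - s) = -(s * ψ' y) := by linarith
        rw [h1s] at h
        have : s * (ψ i y - ψ i a * ψ' y) = 0 := by linear_combination h
        exact sub_eq_zero.1 ((mul_eq_zero.1 this).resolve_left hs0.ne')
    · rintro ⟨hle, heq⟩
      have hden : 0 < 1 - ψ' y := by linarith
      refine ⟨1 / (1 - ψ' y), by positivity, (div_le_one hden).2 (by linarith), (hψ _).2 fun i => ?_⟩
      rw [affineMap_combo, heq i]
      field_simp
      ring

/-- **Dimension of the shadow**: an affinely independent finite set inside a radial cell of `A`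
from `a`, and inside an affine subspace `N₀` not containing `a`, has at most
`dim A + 1` points (`dim Λ ≤ dim Σ + 1` of Rushing's Lemma 1.6.3: the radial cell lies in the
join of `a` and `A`, whose trace on `N₀ ∌ a` is a proper sub-flat). [folklore] -/
theorem card_le_of_subset_radialCell {a : E} {A N₀ : AffineSubspace ℝ E} (haN : a ∉ N₀)
    {t : Finset E} (ht : AffineIndependent ℝ ((↑) : t → E))
    (htc : (t : Set E) ⊆ radialCell a A) (htN : (t : Set E) ⊆ N₀) :
    t.card ≤ Module.finrank ℝ A.direction + 1 := by
  rcases t.eq_empty_or_nonempty with rfl | hne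
  · simp
  obtain ⟨y₀, hy₀⟩ := hne
  obtain ⟨s₀, hs₀, -, hq₀⟩ := htc (Finset.mem_coe.2 hy₀)
  set q₀ : E := (1 - s₀) • a + s₀ • y₀ with hq₀def
  -- the join `M` of `a` and `A`
  set D : Submodule ℝ E := A.direction ⊔ (ℝ ∙ (q₀ - a)) with hD
  set M : AffineSubspace ℝ E := AffineSubspace.mk' a D with hM
  have hDfin : Module.finrank ℝ D ≤ Module.finrank ℝ A.direction + 1 := by
    refine (Submodule.finrank_add_le_finrank_add_finrank _ _).trans ?_
    gcongr
    exact (finrank_span_le_card ({q₀ - a} : Set E)).trans (by simp)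
  have hcellM : radialCell a A ⊆ M := by
    rintro y ⟨s, hs, -, hsA⟩
    show y ∈ M
    rw [hM, AffineSubspace.mem_mk', vsub_eq_sub]
    -- `y - a = s⁻¹ • (q - a)` with `q ∈ A`, and `q - a = (q - q₀) + (q₀ - a)`
    set q : E := (1 - s) • a + s • y with hq
    have hya : y - a = s⁻¹ • (q - a) := by
      rw [hq]
      have : (1 - s) • a + s • y - a = s • (y - a) := by module
      rw [this, smul_smul, inv_mul_cancel₀ hs.ne', one_smul]
    rw [hya]
    refine Submodule.smul_mem _ _ ?_
    have hsplit : q - a = (q - q₀) + (q₀ - a) := by abel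
    rw [hsplit]
    refine Submodule.add_mem _ (Submodule.mem_sup_left ?_) (Submodule.mem_sup_right
      (Submodule.mem_span_singleton_self _))
    have h := AffineSubspace.vsub_mem_direction hsA hq₀
    rwa [vsub_eq_sub] at h
  -- the trace `M' = M ⊓ N₀` is a proper sub-flat of `M`
  set M' : AffineSubspace ℝ E := M ⊓ N₀ with hM'
  have htM' : (t : Set E) ⊆ M' := fun y hy => ⟨hcellM (htc hy), htN hy⟩
  have hM'ne : (M' : Set E).Nonempty := ⟨y₀, htM' (Finset.mem_coe.2 hy₀)⟩
  have hlt : M' < M := by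
    refine lt_of_le_of_ne inf_le_left fun h => haN ?_
    have haM : a ∈ M := AffineSubspace.self_mem_mk' a D
    rw [← h] at haM
    exact haM.2
  have hdir : Module.finrank ℝ M'.direction < Module.finrank ℝ D := by
    have h := Submodule.finrank_lt_finrank_of_lt (AffineSubspace.direction_lt_of_nonempty hlt hM'ne)
    rwa [hM, AffineSubspace.direction_mk'] at h
  -- and carries the affinely independent `t`
  have hvs : vectorSpan ℝ (t : Set E) ≤ M'.direction := by
    rw [← direction_affineSpan]
    exact AffineSubspace.direction_le (affineSpan_le.2 htM')
  have hcard : Module.finrank ℝ (vectorSpan ℝ (t : Set E)) + 1 = t.card := by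
    haveI : Nonempty ↥t := ⟨⟨y₀, hy₀⟩⟩
    have h := ht.finrank_vectorSpan_add_one
    rw [Subtype.range_coe_subtype, Finset.setOf_mem, Fintype.card_coe] at h
    exact h
  have h1 := Submodule.finrank_mono hvs
  omega

end ConeShadow

/-! ### The cone-shadow triangulation and stretch (Rushing, Lemma 1.6.3 with Exercise 1.6.12) -/

section ConeShadowStretch

variable {E : Type*} [NormedAddCommGroup E] [NormedSpace ℝ E] [FiniteDimensional ℝ E]
  [DecidableEq E]

omit [FiniteDimensional ℝ E] [DecidableEq E] in
/-- Reindexing a cell along a slice of a sigma type. [folklore] -/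
theorem cellSet_sigma {κ : Type*} {β : κ → Type*} (L : (Σ k, β k) → E →ᵃ[ℝ] ℝ) (k : κ)
    (J Z : Set (β k)) :
    cellSet L (Sigma.mk k '' J) (Sigma.mk k '' Z) = cellSet (fun b => L ⟨k, b⟩) J Z := by
  ext x
  simp only [mem_cellSet_iff, mem_image, forall_exists_index, and_imp, forall_apply_eq_imp_iff₂]

/-- **The cone-shadow triangulation of a simplex** (Rushing, Lemma 1.6.3 specialised to a simplex
`conv T = a * B` collapsing onto its horn `a * ∂B`, and Exercise 1.6.12 for it).  Given finitely
many affine subspaces `A ℓ` (cutting out the cells `conv T ∩ A ℓ` of a singular set `Σ`), there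
is a finite triangulation `K` of the free face `B = T ∖ {a}` and a subfamily `K₀`, closed under
subfaces, such that: the subcone `a * K₀` contains the horn and every `conv T ∩ A ℓ`
(`Σ ⊆ Λ ∪ horn`); every face of `K₀` either cones into the horn or lies in the radial cell of
some `A ℓ` with at most `dim (A ℓ) + 1` vertices (`dim Λ ≤ dim Σ + 1`); the total cone
`a * K` is `conv T`; and for any closed `F` meeting `conv T` only inside `a * K₀`, open
`O ⊇ a * K₀` and open `N ⊇ conv T` there is a self-homeomorphism of `E`, the identity on `F`
and off a compact subset of `N`, stretching `O` over `conv T`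
(`conv T ↘ a * K₀ ∪ … ↘ horn` realised by `exists_homeomorph_coneOver_subset_image`).
[cite: Rushing1973, Lemma 1.6.3 and Exercise 1.6.12] -/
theorem exists_coneShadow_triangulation {T : Finset E} (hT : AffineIndependent ℝ ((↑) : T → E))
    {a : E} (ha : a ∈ T) (hB : (T.erase a).Nonempty) {κ : Type*} [Fintype κ]
    (A : κ → AffineSubspace ℝ E) :
    ∃ (K : Geometry.SimplicialComplex ℝ E) (K₀ : Set (Finset E)), K.faces.Finite ∧
      K.space = convexHull ℝ ((T.erase a : Finset E) : Set E) ∧ K₀ ⊆ K.faces ∧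
      (∀ τ ∈ K₀, ∀ τ' ∈ K.faces, τ' ⊆ τ → τ' ∈ K₀) ∧
      simplexHorn T a ⊆ coneOver a K₀ ∧
      (∀ ℓ, convexHull ℝ (T : Set E) ∩ (A ℓ : Set E) ⊆ coneOver a K₀) ∧
      (∀ τ ∈ K₀, convexHull ℝ (↑(insert a τ) : Set E) ⊆ simplexHorn T a ∨
        ∃ ℓ, (τ : Set E) ⊆ radialCell a (A ℓ) ∧ τ.card ≤ Module.finrank ℝ (A ℓ).direction + 1) ∧
      coneOver a K.faces = convexHull ℝ (T : Set E) ∧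
      ∀ F O N : Set E, IsClosed F → IsOpen O → IsOpen N →
        (∀ x ∈ F, x ∈ convexHull ℝ (T : Set E) → x ∈ coneOver a K₀) → coneOver a K₀ ⊆ O →
        convexHull ℝ (T : Set E) ⊆ N →
        ∃ G : E ≃ₜ E, (∀ x ∈ F, G x = x) ∧
          (∃ C : Set E, IsCompact C ∧ C ⊆ N ∧ ∀ x, x ∉ C → G x = x) ∧
          convexHull ℝ (T : Set E) ⊆ G '' O := by
  set B : Finset E := T.erase a with hBdef
  have hBT : B ⊆ T := Finset.erase_subset a T
  have hTins : T = insert a B := (Finset.insert_erase ha).symm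
  have haB : a ∉ B := Finset.notMem_erase a T
  have hBind : AffineIndependent ℝ ((↑) : B → E) := hT.mono (Finset.coe_subset.2 hBT)
  -- `a` is off the affine span of `B`
  have haspan : a ∉ affineSpan ℝ (B : Set E) := by
    have h := hT.notMem_affineSpan_sdiff ⟨a, ha⟩ (Set.univ : Set ↥T)
    have himg : ((↑) : ↥T → E) '' (Set.univ \ {⟨a, ha⟩}) = (B : Set E) := by
      ext x
      simp only [mem_image, Set.mem_sdiff, Set.mem_univ, Set.mem_singleton_iff, true_and,
        Finset.mem_coe, hBdef, Finset.mem_erase]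
      constructor
      · rintro ⟨⟨y, hy⟩, hne, rfl⟩
        exact ⟨fun h => hne (Subtype.ext h), hy⟩
      · rintro ⟨hne, hx⟩
        exact ⟨⟨x, hx⟩, fun h => hne (congrArg Subtype.val h), rfl⟩
    rwa [himg] at h
  -- H-descriptions and radial cells
  have hH : ∀ ℓ, ∃ (m : ℕ) (L : Option (Fin m) → E →ᵃ[ℝ] ℝ) (J Z : Set (Option (Fin m))),
      radialCell a (A ℓ) = cellSet L J Z := fun ℓ => by
    obtain ⟨m, ψ, hψ⟩ := exists_mem_affineSubspace_iff_forall_eq_zero (A ℓ)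
    obtain ⟨L, J, Z, h⟩ := radialCell_eq_cellSet (a := a) hψ
    exact ⟨m, L, J, Z, h⟩
  choose m L J Z hLJZ using hH
  -- one arrangement for all radial cells
  let L₀ : (Σ ℓ, Option (Fin (m ℓ))) → E →ᵃ[ℝ] ℝ := fun p => L p.1 p.2
  obtain ⟨K, hfin, hspace, hfaces, hcells⟩ := exists_triangulation_cells_subcomplex hBind L₀
    (fun ℓ => Sigma.mk ℓ '' J ℓ) (fun ℓ => Sigma.mk ℓ '' Z ℓ)
  have hcell : ∀ ℓ, cellSet L₀ (Sigma.mk ℓ '' J ℓ) (Sigma.mk ℓ '' Z ℓ) = radialCell a (A ℓ) :=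
    fun ℓ => by rw [cellSet_sigma, ← hLJZ ℓ]
  -- the subfamily
  set K₀ : Set (Finset E) := {τ | τ ∈ K.faces ∧
    ((∃ b ∈ B, convexHull ℝ (τ : Set E) ⊆ convexHull ℝ ((B.erase b : Finset E) : Set E)) ∨
      ∃ ℓ, convexHull ℝ (τ : Set E) ⊆ radialCell a (A ℓ))} with hK₀def
  have hK₀K : K₀ ⊆ K.faces := fun τ hτ => hτ.1
  have hK₀down : ∀ τ ∈ K₀, ∀ τ' ∈ K.faces, τ' ⊆ τ → τ' ∈ K₀ := by
    rintro τ ⟨-, hτ⟩ τ' hτ'K hsub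
    have hmono : convexHull ℝ (τ' : Set E) ⊆ convexHull ℝ (τ : Set E) :=
      convexHull_mono (Finset.coe_subset.2 hsub)
    rcases hτ with ⟨b, hb, h⟩ | ⟨ℓ, h⟩
    · exact ⟨hτ'K, Or.inl ⟨b, hb, hmono.trans h⟩⟩
    · exact ⟨hτ'K, Or.inr ⟨ℓ, hmono.trans h⟩⟩
  -- faces lie in `conv B`, hence in `aff B`
  have hconvB : ∀ τ ∈ K.faces, convexHull ℝ (τ : Set E) ⊆ convexHull ℝ (B : Set E) := fun τ hτ => by
    rw [← hspace]; exact K.convexHull_subset_space hτ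
  have hKP : ∀ τ ∈ K.faces, ((τ : Finset E) : Set E) ⊆ affineSpan ℝ (B : Set E) := fun τ hτ =>
    ((subset_convexHull ℝ _).trans (hconvB τ hτ)).trans (convexHull_subset_affineSpan _)
  -- segments from `a` to a simplex through a point
  have hseg : ∀ {y : E} {τ : Finset E}, τ ∈ K.faces → y ∈ convexHull ℝ (τ : Set E) →
      segment ℝ a y ⊆ convexHull ℝ (↑(insert a τ) : Set E) := fun {y τ} _ hy => by
    rw [Finset.coe_insert]
    exact (convex_convexHull ℝ _).segment_subset (subset_convexHull ℝ _ (mem_insert a _))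
      (convexHull_mono (subset_insert a _) hy)
  -- the total cone is `conv T`
  have haT : a ∈ convexHull ℝ (T : Set E) := subset_convexHull ℝ _ (Finset.mem_coe.2 ha)
  have hcone : coneOver a K.faces = convexHull ℝ (T : Set E) := by
    apply Subset.antisymm
    · rintro x (hx | hx)
      · rw [mem_singleton_iff.1 hx]; exact haT
      · obtain ⟨τ, hτ, hxτ⟩ := mem_iUnion₂.1 hx
        refine convexHull_min ?_ (convex_convexHull ℝ _) hxτ
        rw [Finset.coe_insert]
        exact insert_subset haT (((subset_convexHull ℝ _).trans (hconvB τ hτ)).trans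
          (convexHull_mono (Finset.coe_subset.2 hBT)))
    · intro x hx
      rw [hTins, Finset.coe_insert, convexHull_insert (Finset.coe_nonempty.2 hB),
        convexJoin_singleton_left] at hx
      obtain ⟨y, hy, hxy⟩ := mem_iUnion₂.1 hx
      have hyK : y ∈ K.space := by rw [hspace]; exact hy
      obtain ⟨τ, hτ, hyτ⟩ := Geometry.SimplicialComplex.mem_space_iff.1 hyK
      exact Or.inr (mem_iUnion₂.2 ⟨τ, hτ, hseg hτ hyτ hxy⟩)
  -- the horn lies in the subcone
  have hhorn : simplexHorn T a ⊆ coneOver a K₀ := by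
    intro x hx
    obtain ⟨b, hb, hxb⟩ := mem_iUnion₂.1 hx
    have hbB : b ∈ B := hb
    have hTb : T.erase b = insert a (B.erase b) := by
      rw [hTins, Finset.erase_insert_of_ne fun h => haB (by rw [h]; exact hbB)]
    rw [hTb, Finset.coe_insert] at hxb
    rcases (B.erase b).eq_empty_or_nonempty with h0 | hne
    · rw [h0, Finset.coe_empty, insert_empty_eq, convexHull_singleton, mem_singleton_iff] at hxb
      rw [hxb]; exact apex_mem_coneOver a K₀
    · rw [convexHull_insert (Finset.coe_nonempty.2 hne), convexJoin_singleton_left] at hxb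
      obtain ⟨y, hy, hxy⟩ := mem_iUnion₂.1 hxb
      obtain ⟨τ, hτ, hyτ, hτsub⟩ := hfaces (B.erase b) (Finset.erase_subset b B) y hy
      have hτ₀ : τ ∈ K₀ := ⟨hτ, Or.inl ⟨b, hbB, hτsub⟩⟩
      exact convexHull_subset_coneOver a hτ₀ (hseg hτ hyτ hxy)
  -- the singular cells lie in the subcone
  have hsing : ∀ ℓ, convexHull ℝ (T : Set E) ∩ (A ℓ : Set E) ⊆ coneOver a K₀ := by
    rintro ℓ x ⟨hxT, hxA⟩
    rw [hTins, Finset.coe_insert] at hxT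
    rcases eq_or_exists_mem_radialCell (Finset.coe_nonempty.2 hB) hxT hxA with rfl | ⟨y, hy, hyc, hxy⟩
    · exact apex_mem_coneOver _ K₀
    · rw [← hcell ℓ] at hyc
      obtain ⟨τ, hτ, hyτ, hτsub⟩ := hcells ℓ y hy hyc
      rw [hcell ℓ] at hτsub
      have hτ₀ : τ ∈ K₀ := ⟨hτ, Or.inr ⟨ℓ, hτsub⟩⟩
      exact convexHull_subset_coneOver a hτ₀ (hseg hτ hyτ hxy)
  -- the dichotomy for faces of `K₀`
  have hdich : ∀ τ ∈ K₀, convexHull ℝ (↑(insert a τ) : Set E) ⊆ simplexHorn T a ∨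
      ∃ ℓ, (τ : Set E) ⊆ radialCell a (A ℓ) ∧ τ.card ≤ Module.finrank ℝ (A ℓ).direction + 1 := by
    rintro τ ⟨hτK, ⟨b, hb, hτb⟩ | ⟨ℓ, hτℓ⟩⟩
    · left
      have hTb : (T.erase b : Set E) = insert a ((B.erase b : Finset E) : Set E) := by
        rw [hTins, Finset.erase_insert_of_ne fun h => haB (by rw [h]; exact hb), Finset.coe_insert]
      refine (convexHull_min ?_ (convex_convexHull ℝ _)).trans
        (subset_iUnion₂ (s := fun b' _ => convexHull ℝ ((T.erase b' : Finset E) : Set E)) b hb)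
      rw [Finset.coe_insert, hTb]
      refine insert_subset (subset_convexHull ℝ _ (mem_insert a _)) ?_
      exact ((subset_convexHull ℝ _).trans hτb).trans (convexHull_mono (subset_insert a _))
    · right
      refine ⟨ℓ, (subset_convexHull ℝ _).trans hτℓ, ?_⟩
      exact card_le_of_subset_radialCell haspan (K.indep hτK)
        ((subset_convexHull ℝ _).trans hτℓ) (hKP τ hτK)
  refine ⟨K, K₀, hfin, hspace, hK₀K, hK₀down, hhorn, hsing, hdich, hcone, ?_⟩
  -- the stretch
  intro F O N hF hO hN hFc hOc hNc
  have hNc' : ∀ τ ∈ K.faces, convexHull ℝ (↑(insert a τ) : Set E) ⊆ N := fun τ hτ =>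
    (hcone ▸ convexHull_subset_coneOver a hτ).trans hNc
  obtain ⟨G, hGF, hGC, hGO⟩ := exists_homeomorph_coneOver_subset_image hfin hKP haspan hK₀K hK₀down
    hF hO hN (fun x hx τ hτ hxτ => hFc x hx (hcone ▸ convexHull_subset_coneOver a hτ hxτ)) hOc hNc'
  rw [hcone] at hGO
  exact ⟨G, hGF, hGC, hGO⟩

end ConeShadowStretch

end Literature.Topology.FourManifolds
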